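import Literature.IUT.HodgeArakelov.EtaleThetaDataOfSettingInversion
import Literature.AnabelianGeometry.EtaleTheta.SettingModelMuTwoInversion
import HarnessLib

/-!
# [IUTchII] Prop 2.2 (ii) at the MODEL, datum `ι := (ε_±-conjugation)|Π^tp_X`: the two [EtTh] Def. 1.7 models
# (GAP row G-w4d010-2, facets (R1b′)/(R1c)/(R1d)/(R1e′) of D-G-w4d010-2h — a kernel dichotomy)

abc-iut cell (WAVE-5 seat abc-iut-w5-d072 gen 3, (R1) ι-datum custody; DAG node **IUTchII:Prop2.2(ii)**; plan/GAP-LEDGER.md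
D-G-w4d010-2h). S. Mochizuki, *Inter-universal Teichmüller theory II* (kurims, Dec. 2020), Rmk. 1.4.1 (ii) p. 28, Prop. 2.2 (ii)
pp. 65–67 (claim key `Mochizuki2012`, DISPUTED, D-0012); S. Mochizuki, *The étale theta function …*, Publ. RIMS **45** (2009)
[EtTh] Def. 1.7 p. 27 (`ε_± ∈ Gal(Ẍ/C)` lifting `−1`), §2 p. 36 («multiplication by `−1`»), Prop. 2.2 (i) p. 37.

PROOF-ONLY (no definitions, no `Prop`-valued facts). §3 of `EtaleThetaDataOfSettingInversion.lean` (p416287) defines, for ANY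
`M : MuTwoSetting p`, the group automorphism `epsPMConj M` of `Π^tp_X` (= conjugation by `ε_±` pulled back along `inclX`) and —
under the binder (R1d) `hind : IsInducing M.inclX` — the topological automorphism `epsPMInversion M hind`, the print-shaped
CANDIDATE for the datum `ι` of the Prop. 2.2 (ii) closers (`prop22_ii'_model_of_epsPM`, `prop22_ii'_model_of_inversion_of_hinv`
p420219, abc-iut-w4-d043's `EtaleLevels.cor112_ii_model` p420795), whose remaining (R1) facets are NAMED binders:
(R1b′) `hΔ`, (R1c) `hZ`, (R1e′) `hinv` («`ι̂ ≡ −1` on `Δ_X^ab`»). This file evaluates the candidate at the TWO kernel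
inhabitants of the Def. 1.7 interface over the root `ThetaSetting.model p`:

* §1 **abc-iut-L2-t1's product model `MuTwoSetting.model p`** (`Π^tp_C := Π^tp_X × ℤ/2`, p421643): `ε_±` is CENTRAL, so
  `epsPMConj_model : epsPMConj (model p) x = x` and `epsPMInversion (model p) hind = refl`; hence **(R1e′) FAILS there**
  (`not_hinv_epsPMInversion_model`, by `SettingModel.not_hinv_refl` p424489) and so does (R1c) (`not_hZ_epsPMInversion_model`:
  `toZ (ι a) = toZ a = 1 ≠ −1`) — the kernel form of abc-iut-w4-d014's audit observation P1 (STATUS 2026-08-26T04:35:03Z).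
* §2 **abc-iut-w5-d072's semidirect model `MuTwoSetting.inversionModel p`** (`Π^tp_C := Π^tp_X ⋊_ι ℤ/2`,
  `SettingModelMuTwoInversion.lean`): `epsPMConj_inversionModel : epsPMConj (inversionModel p) x = SettingModel.inversion p x`
  (`a ↦ a⁻¹`, `b ↦ b⁻¹` on `F₂`, identity on `Γ`), `epsPMInversion_inversionModel : epsPMInversion (inversionModel p) hind =
  SettingModel.inversion p`; hence **(R1b′), (R1c), (R1e′) all HOLD there** BY NAME from `SettingModelInversion.lean`
  (`map_deltaTemp_inversion`, `toZ_inversion`, `inversion_hinv`).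
* §3 headline `exists_muTwoSetting_epsPMInversion_hinv`: **∃ `M : MuTwoSetting p`, ∃ `hind`, with the origin guard and an
  admissible `ε_Z`, such that `ι := epsPMInversion M hind` is `≠ 1` and satisfies (R1b′) ∧ (R1c) ∧ (R1e′)** — the binders
  `hind`/`hΔ`/`hZ`/`hinv` of the Prop. 2.2 (ii) closers AT `ι := (ε_±-conjugation)` are JOINTLY SATISFIABLE with [EtTh] Def. 1.7's
  interface; and `epsPM_facets_model_dependent`: they are NOT consequences of that interface (§1) — i.e. (R1c)/(R1e′) record
  genuine content of print's `ε_±` («lifts `−1`»), correctly carried as named inputs / a future interface field.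

HONEST LIMITS: both models are semi-synthetic and degenerate along the tempered topology (discrete `Π^tp`; root `Π^tp_X = F₂ × G_{ℚ_p}`
a direct product, so the Kummer-level data `KummerData`/`DoubleUnderline` over them are vacuous — abc-iut-L2-lead R77 — and the facet
(R1a) `hι` and the (R2)(R3) translate binders are not exercised). Nothing here bears on [IUTchIII] Cor. 3.12; [IUTchII] carries the
disputed claim key by cell policy; typed ≠ proved; instantiated ≠ endorsed.
-/

noncomputable section

namespace Literature.IUT.HodgeArakelov

namespace EtaleThetaDataOfSetting

open Literature.AnabelianGeometry.EtaleTheta Literature.AnabelianGeometry.EtaleTheta.SettingModel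
open Literature.AnabelianGeometry.SemiGraphs
open _root_.Topology

variable (p : ℕ) [Fact p.Prime]

/-! ## §1. The product model: `ε_±` central, the candidate `ι` is the identity, (R1c)/(R1e′) fail -/

/-- **At abc-iut-L2-t1's `MuTwoSetting.model p` conjugation by `ε_±` is the IDENTITY of `Π^tp_X`** (`Π^tp_C = Π^tp_X × ℤ/2`,
`ε_± = (1, 1̄)` is central). [cite: MochizukiEtTh2009, Def 1.7 p.27] -/
theorem epsPMConj_model (x : PiTp p) : epsPMConj (MuTwoSetting.model p) x = x := by
  apply (MuTwoSetting.model p).injective_inclX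
  rw [inclX_epsPMConj]
  change ((1, Multiplicative.ofAdd 1) : PiC p) * (x, 1) * ((1, Multiplicative.ofAdd 1) : PiC p)⁻¹ = (x, 1)
  ext <;> simp

/-- Hence the candidate datum `ι := epsPMInversion (model p) hind` is the identity automorphism, for every `hind`.
[cite: MochizukiEtTh2009, Def 1.7 p.27] -/
theorem epsPMInversion_model (hind : IsInducing (MuTwoSetting.model p).inclX) :
    epsPMInversion (MuTwoSetting.model p) hind = ContinuousMulEquiv.refl _ :=
  ContinuousMulEquiv.ext (epsPMConj_model p)

/-- **(R1e′) FAILS for `ε_±` of the product model**: «`ι̂ ≡ −1` on `Δ_X^ab`» is false for `ι := epsPMInversion (model p) hind`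
(it is the identity; `ι_X(a)² ∉ closure ⁅Δ_X,Δ_X⁆`, `SettingModel.not_hinv_refl`). Kernel form of abc-iut-w4-d014's P1.
[cite: MochizukiEtTh2009, Prop 2.2 (i) p.37] -/
theorem not_hinv_epsPMInversion_model (hind : IsInducing (MuTwoSetting.model p).inclX) :
    ¬ ∀ g ∈ (MuTwoSetting.model p).DeltaHat,
      (MuTwoSetting.model p).completionAut (epsPMInversion (MuTwoSetting.model p) hind) g * g ∈
        (⁅(MuTwoSetting.model p).DeltaHat, (MuTwoSetting.model p).DeltaHat⁆).topologicalClosure := by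
  rw [epsPMInversion_model]
  exact not_hinv_refl p

/-- **(R1c) FAILS for `ε_±` of the product model**: `toZ (ι a) = toZ a = 1 ≠ (toZ a)⁻¹`. [cite: Mochizuki2012, Prop 2.2 (ii) p.66] -/
theorem not_hZ_epsPMInversion_model (hind : IsInducing (MuTwoSetting.model p).inclX) :
    ¬ ∀ g ∈ (MuTwoSetting.model p).DeltaTemp,
      (MuTwoSetting.model p).toZ (epsPMInversion (MuTwoSetting.model p) hind g) = ((MuTwoSetting.model p).toZ g)⁻¹ := by
  intro h
  have h1 := h (genA p) (genA_mem_deltaTemp p)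
  rw [epsPMInversion_model, ContinuousMulEquiv.coe_refl, id] at h1
  change (ThetaSetting.model p).toZ (genA p) = ((ThetaSetting.model p).toZ (genA p))⁻¹ at h1
  rw [toZ_genA, ← ofAdd_neg] at h1
  have h2 : (1 : ℤ) = -1 := Multiplicative.ofAdd.injective h1
  omega

/-! ## §2. The semidirect model: `ε_±`-conjugation is the pointed inversion, (R1b′)/(R1c)/(R1e′) hold -/

/-- **At `MuTwoSetting.inversionModel p` conjugation by `ε_±` IS the pointed inversion `SettingModel.inversion p`**
(`a ↦ a⁻¹`, `b ↦ b⁻¹`, identity on the Galois factor). [cite: MochizukiEtTh2009, §2 p.36] -/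
theorem epsPMConj_inversionModel (x : PiTp p) : epsPMConj (MuTwoSetting.inversionModel p) x = inversion p x := by
  apply (MuTwoSetting.inversionModel p).injective_inclX
  rw [inclX_epsPMConj]
  exact MuTwoSetting.inversionModel_epsPM_conj p x

/-- Hence `epsPMInversion (inversionModel p) hind = SettingModel.inversion p` (for every `hind`). [cite: MochizukiEtTh2009, §2 p.36] -/
theorem epsPMInversion_inversionModel (hind : IsInducing (MuTwoSetting.inversionModel p).inclX) :
    epsPMInversion (MuTwoSetting.inversionModel p) hind = inversion p :=
  ContinuousMulEquiv.ext (epsPMConj_inversionModel p)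

/-- **(R1b′) holds for `ε_±` of the semidirect model**: `ι(Δ^tp_X) = Δ^tp_X`. [cite: Mochizuki2012, Rmk 1.4.1 (ii) p.28] -/
theorem map_deltaTemp_epsPMInversion_inversionModel (hind : IsInducing (MuTwoSetting.inversionModel p).inclX) :
    (MuTwoSetting.inversionModel p).DeltaTemp.map
        (epsPMInversion (MuTwoSetting.inversionModel p) hind).toMulEquiv.toMonoidHom =
      (MuTwoSetting.inversionModel p).DeltaTemp := by
  rw [epsPMInversion_inversionModel]
  exact map_deltaTemp_inversion p

/-- **(R1c) holds for `ε_±` of the semidirect model**: `toZ (ι g) = (toZ g)⁻¹` for all `g`. [cite: Mochizuki2012, Prop 2.2 (ii) p.66] -/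
theorem toZ_epsPMInversion_inversionModel (hind : IsInducing (MuTwoSetting.inversionModel p).inclX) (g : PiTp p) :
    (MuTwoSetting.inversionModel p).toZ (epsPMInversion (MuTwoSetting.inversionModel p) hind g) =
      ((MuTwoSetting.inversionModel p).toZ g)⁻¹ := by
  rw [epsPMInversion_inversionModel]
  exact toZ_inversion p g

/-- **(R1e′) holds for `ε_±` of the semidirect model**: «`ι̂ ≡ −1` on `Δ_X^ab`». [cite: MochizukiEtTh2009, Prop 2.2 (i) p.37] -/
theorem hinv_epsPMInversion_inversionModel (hind : IsInducing (MuTwoSetting.inversionModel p).inclX) :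
    ∀ g ∈ (MuTwoSetting.inversionModel p).DeltaHat,
      (MuTwoSetting.inversionModel p).completionAut (epsPMInversion (MuTwoSetting.inversionModel p) hind) g * g ∈
        (⁅(MuTwoSetting.inversionModel p).DeltaHat, (MuTwoSetting.inversionModel p).DeltaHat⁆).topologicalClosure := by
  rw [epsPMInversion_inversionModel]
  exact inversion_hinv p

/-- `ε_±` of the semidirect model is a NONTRIVIAL (outer) automorphism of `Π^tp_X`. [cite: MochizukiEtTh2009, Def 1.7 p.27] -/
theorem epsPMInversion_inversionModel_ne_refl (hind : IsInducing (MuTwoSetting.inversionModel p).inclX) :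
    epsPMInversion (MuTwoSetting.inversionModel p) hind ≠ ContinuousMulEquiv.refl _ := by
  rw [epsPMInversion_inversionModel]
  exact inversion_ne_refl p

/-! ## §3. Joint satisfiability and model-dependence of the `ε_±`-facets -/

/-- **The binders (R1d) `hind`, (R1b′) `hΔ`, (R1c) `hZ`, (R1e′) `hinv` of the [IUTchII] Prop. 2.2 (ii) model closers AT THE
PRINT-SHAPED DATUM `ι := (ε_±-conjugation)|Π^tp_X` are jointly satisfiable with [EtTh] Def. 1.7's interface `MuTwoSetting`, its
origin guard and an admissible `ε_Z`** — witness `MuTwoSetting.inversionModel p`. [cite: Mochizuki2012, Prop 2.2 (ii) p.66] -/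
theorem exists_muTwoSetting_epsPMInversion_hinv :
    ∃ (M : MuTwoSetting p) (hind : IsInducing M.inclX), M.toThetaSetting.IsEtThOrigin ∧
      (∃ εZ : M.GtpC, M.IsAdmissibleEpsZ εZ) ∧ epsPMInversion M hind ≠ ContinuousMulEquiv.refl _ ∧
      M.DeltaTemp.map (epsPMInversion M hind).toMulEquiv.toMonoidHom = M.DeltaTemp ∧
      (∀ g, M.toZ (epsPMInversion M hind g) = (M.toZ g)⁻¹) ∧
      ∀ g ∈ M.DeltaHat, M.completionAut (epsPMInversion M hind) g * g ∈ (⁅M.DeltaHat, M.DeltaHat⁆).topologicalClosure :=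
  ⟨MuTwoSetting.inversionModel p, MuTwoSetting.isInducing_inclX_inversionModel p,
    MuTwoSetting.inversionModel_isEtThOrigin p, ⟨_, MuTwoSetting.inversionModel_isAdmissibleEpsZ p⟩,
    epsPMInversion_inversionModel_ne_refl p _, map_deltaTemp_epsPMInversion_inversionModel p _,
    toZ_epsPMInversion_inversionModel p _, hinv_epsPMInversion_inversionModel p _⟩

/-- **The `ε_±`-facets (R1c)/(R1e′) are NOT consequences of the Def. 1.7 interface** (even with the origin guard, an admissible
`ε_Z` and (R1d)): they fail at the product model — so they are genuine extra content of print's `ε_±` («lifts `−1`», [EtTh]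
p. 27/36), to be carried as named inputs or a future interface field. [cite: MochizukiEtTh2009, Def 1.7 p.27] -/
theorem epsPM_facets_model_dependent :
    ∃ (M : MuTwoSetting p) (hind : IsInducing M.inclX), M.toThetaSetting.IsEtThOrigin ∧
      (∃ εZ : M.GtpC, M.IsAdmissibleEpsZ εZ) ∧
      (¬ ∀ g ∈ M.DeltaTemp, M.toZ (epsPMInversion M hind g) = (M.toZ g)⁻¹) ∧
      ¬ ∀ g ∈ M.DeltaHat, M.completionAut (epsPMInversion M hind) g * g ∈ (⁅M.DeltaHat, M.DeltaHat⁆).topologicalClosure :=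
  ⟨MuTwoSetting.model p, MuTwoSetting.isInducing_inclX_model p, MuTwoSetting.model_isEtThOrigin p,
    ⟨_, MuTwoSetting.model_isAdmissibleEpsZ p⟩, not_hZ_epsPMInversion_model p _, not_hinv_epsPMInversion_model p _⟩

end EtaleThetaDataOfSetting

end Literature.IUT.HodgeArakelov

end
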